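/-
Copyright (c) 2026 the pub-hodgecm-mathlib formalisation cell (harness21).  Prover seat hodgecm-mathlib-A-p12 (g25): road «S3-ram» (LEAD F0P3a-plan (g13); (Cnt2′) chair
F0P3a-p07 (g15) RULING (13) organ (4b), RULING (21) (g3); (α) keeper F0P3a-p06 (g16)); organ (K4b) tokens, ED. 2–3 (arbitrary unit class constant; regime-free scalar key); 2026-09-02.
-/
import Literature.NumberTheory.Rogawski1990.DepthZeroKappaTransferTypeTwoRamifiedHyperbolicVertexTokens   -- ★ p849511 (this seat): the tokens file; brings (K4b) 1/3, (K4a), (K3)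
import HarnessLib

/-!
# The ramified `κ`-orbital integral, TYPE (2): THE BIG TOKEN `Qbig_t` AGAINST AN ARBITRARY UNIT CLASS CONSTANT, READ ON AN ADAPTED AXIS FRAME
# (organ (4b) tokens, ED. 2; Kottwitz 1986 §3; Rogawski 1990 §4.9; Labesse–Langlands 1979 §2)

Topic `NumberTheory/Rogawski1990`; namespace `Literature.NumberTheory.Rogawski1990.TypeOneRamifiedJunction`.  THEOREMS ONLY (no definition, no instance, no notation, no
named fact, no `sorry`); kernel lane `--supports stmt-HodgeConjecture-24833`; datum-free; count-neutral.  Cell `pub/hodgecm-mathlib` (D-0151), crux H413; (Cnt2′) ROUTE B,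
chair RULING (13) organ (4b) (A-p12 (g25)) and RULING (21) (A-even per-vertex glue (g3), F0P3-p02 (g17) ∕ A-p19 (g29)).  ★ `big_token_iff_of_axisFrame` keyed the BIG token on the
regime-B scalar key (`res CO = −res T₀ ≠ 0`); here the SAME computation is stated for an ARBITRARY residual unit `t` as class constant and WITHOUT the scalar key, so it
applies verbatim at the A-even TOP vertex (`res CO = 0`, class constant e.g. `−c₁`):
* **`big_token_iff_of_axisFrame_of_unit`**: `(∃ y ∈ v.1, y₁ = 0 ∧ ∃ a, |a| = 1 ∧ |ϖ^{−d₀}⟨y, (Γ − c·1)y⟩ − t·a²| < 1) ⟺ χ(res LO·res t) = 1` at a vertex with `res LO ≠ 0`;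
* ED. 3 **`residue_CO_eq_neg_residue_T₀_of_trace`**: `res CO = −res T₀` from `tr g₁ = 2c` and J-symmetry alone (no regime; A-even top: `res CO = 0`).
HONEST LABEL: HC_CM is proved only modulo the 2 remaining named inputs (hLiu418 24832, h413 24833) until rung 0 closes; nothing printed is asserted here (lattice
bookkeeping over ★ results); «S3-ram» is Literature seeding, count-neutral.

## References
* [Kottwitz1986] R. E. Kottwitz, *Base change for unit elements of Hecke algebras*, Compositio Math. 60 (1986), §3.
* [Rogawski1990] J. D. Rogawski, *Automorphic Representations of Unitary Groups in Three Variables*, Ann. of Math. Stud. 123 (1990), §4.9 pp. 54–56, Prop. 4.9.1 (b), Lemma 4.9.3.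
* [LabesseLanglands1979] J.-P. Labesse, R. P. Langlands, *L-indistinguishability for SL(2)*, Canad. J. Math. 31 (1979), §2 Lemma 2.1.
* [IrelandRosen1990] K. Ireland, M. Rosen, *A Classical Introduction to Modern Number Theory*, GTM 84 (1990), Ch. 8 §1.
-/

set_option autoImplicit false

noncomputable section

open scoped Valued WithZero Matrix MatrixGroups
open Polynomial Classical SimpleGraph
open Literature.NumberTheory.Automorphic Literature.NumberTheory.Automorphic.HermitianLattice Literature.NumberTheory.Automorphic.UnitaryLatticeTree
open Literature.NumberTheory.Automorphic.UnitaryGroup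

namespace Literature.NumberTheory.Rogawski1990.TypeOneRamifiedJunction

variable {K : Type*} [Field K] [Valued K ℤᵐ⁰] {σ : K →+* K} {ϖ : K}

set_option maxHeartbeats 3200000 in
/-- **(K4b-T4′) THE BIG TOKEN AGAINST AN ARBITRARY UNIT CLASS CONSTANT** (`t ∈ 𝒪`, `res t ≠ 0`; at a vertex with `res LO ≠ 0` on an adapted, J-symmetric AXIS block
frame, `tr g₁ = 2c`): `(∃ y ∈ v.1, y₁ = 0 ∧ ∃ a, |a| = 1 ∧ |ϖ^{−d₀}⟨y, (Γ − c·1)y⟩ − t·a²| < 1) ⟺ χ(res LO·res t) = 1` — ★ `big_token_iff_of_axisFrame` with `T₀ ↦ t` and NO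
scalar key `CO` (the W-part value is `l̄·x̄₂²` by J-symmetry and adaptedness alone, so the A-even TOP vertex, where `res CO = 0`, is covered: chair RULING (21) (g3) for
F0P3-p02 (g17) ∕ A-p19 (g29), class constant `t = −c₁` etc.). [cite: Kottwitz1986, §3] [cite: Rogawski1990, §4.9 Prop. 4.9.1 (b) p. 55] [cite: LabesseLanglands1979, §2 Lemma 2.1]
[cite: IrelandRosen1990, Ch. 8 §1] -/
theorem big_token_iff_of_axisFrame_of_unit [Fintype 𝓀[K]] [DecidableEq 𝓀[K]]
    (hvσ : ∀ a, Valued.v (σ a) = Valued.v a) (hϖ : Valued.v ϖ = WithZero.exp (-1 : ℤ))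
    (hres : ∀ x : K, Valued.v x ≤ 1 → Valued.v (σ x - x) < 1) (h2 : Valued.v (2 : K) = 1)
    (γ u : unitaryGroupOfForm σ ((StdForm.antidiagonal 3).over K)) (k : GL (Fin 2) K) (hu : (u : GL (Fin 3) K) = endoGL (k, (1 : GL (Fin 1) K)))
    {v : {M : Submodule 𝒪[K] (Fin 3 → K) // IsVertex σ ϖ ((StdForm.antidiagonal 3).over K) M}}
    (hvu : v = latticeGraphIso σ ϖ ((StdForm.antidiagonal 3).over K) u ⟨stdLattice K 3, 0, isSelfDualLattice_stdLattice_three_of_v hϖ⟩)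
    (g₁ : GL (Fin 2) K) (hγu : ((u⁻¹ * γ * u : unitaryGroupOfForm σ ((StdForm.antidiagonal 3).over K)) : GL (Fin 3) K) = endoGL (g₁, (1 : GL (Fin 1) K)))
    {c : K} (hc : (g₁ : Matrix (Fin 2) (Fin 2) K).trace = 2 * c) {d₀ : ℕ}
    (hadapt : Valued.v ((ϖ ^ d₀)⁻¹ * (g₁ : Matrix (Fin 2) (Fin 2) K) 1 0) < 1)
    (hsym : Valued.v ((ϖ ^ d₀)⁻¹ * ((((g₁ : Matrix (Fin 2) (Fin 2) K) - 1) 0 0) - (((g₁ : Matrix (Fin 2) (Fin 2) K) - 1) 1 1))) < 1)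
    (T₀ : 𝒪[K]) (hT0 : IsLocalRing.residue 𝒪[K] T₀ ≠ 0)
    (LO : 𝒪[K]) (hLO : (LO : K) = (ϖ ^ d₀)⁻¹ * (g₁ : Matrix (Fin 2) (Fin 2) K) 0 1) (hl : IsLocalRing.residue 𝒪[K] LO ≠ 0) :
    (∃ y ∈ v.1, y 1 = 0 ∧ ∃ a : K, Valued.v a = 1 ∧
        Valued.v ((ϖ ^ d₀)⁻¹ * pairing σ ((StdForm.antidiagonal 3).over K) y
          ((((γ : GL (Fin 3) K) : Matrix (Fin 3) (Fin 3) K) - c • (1 : Matrix (Fin 3) (Fin 3) K)) *ᵥ y) - (T₀ : K) * a ^ 2) < 1) ↔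
      quadraticChar 𝓀[K] (IsLocalRing.residue 𝒪[K] LO * IsLocalRing.residue 𝒪[K] T₀) = 1 := by
  have hϖ0 : ϖ ≠ 0 := fun h0 => by rw [h0, map_zero] at hϖ; exact WithZero.coe_ne_zero hϖ.symm
  have hvϖ0 : Valued.v ϖ ≠ 0 := (Valuation.ne_zero_iff _).2 hϖ0
  have hϖD0 : (ϖ ^ d₀ : K) ≠ 0 := pow_ne_zero _ hϖ0
  have h20 : (2 : K) ≠ 0 := fun h0 => by rw [h0, map_zero] at h2; exact zero_ne_one h2
  have hv2 : Valued.v ((2 : K)⁻¹) = 1 := by rw [map_inv₀, h2, inv_one]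
  have hU : IsUnit (((u : GL (Fin 3) K)) : Matrix (Fin 3) (Fin 3) K).det := Matrix.isUnits_det_units _
  have hv1 := coe_eq_latt_of_eq_latticeGraphIso_root hϖ u hvu
  -- the integral scaled entries of the centred block
  have hvD : Valued.v ((ϖ ^ d₀)⁻¹ : K) * Valued.v ϖ ^ d₀ = 1 := by rw [← map_pow, ← map_mul, inv_mul_cancel₀ hϖD0, map_one]
  have hint : ∀ z : K, Valued.v z ≤ Valued.v ϖ ^ d₀ → Valued.v ((ϖ ^ d₀)⁻¹ * z) ≤ 1 := fun z hz => by
    rw [map_mul]; exact (mul_le_mul' le_rfl hz).trans_eq hvD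
  have hcen := apply_sub_centre_eq_of_trace h20 (g₁ : Matrix (Fin 2) (Fin 2) K) hc
  have hA00v : Valued.v ((ϖ ^ d₀)⁻¹ * ((g₁ : Matrix (Fin 2) (Fin 2) K) 0 0 - c)) < 1 := by
    rw [hcen.1, show (ϖ ^ d₀)⁻¹ * ((((g₁ : Matrix (Fin 2) (Fin 2) K) - 1) 0 0 - ((g₁ : Matrix (Fin 2) (Fin 2) K) - 1) 1 1) / 2) =
      (2 : K)⁻¹ * ((ϖ ^ d₀)⁻¹ * ((((g₁ : Matrix (Fin 2) (Fin 2) K) - 1) 0 0) - (((g₁ : Matrix (Fin 2) (Fin 2) K) - 1) 1 1))) by ring, map_mul, hv2, one_mul]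
    exact hsym
  have hA11v : Valued.v ((ϖ ^ d₀)⁻¹ * ((g₁ : Matrix (Fin 2) (Fin 2) K) 1 1 - c)) < 1 := by
    rw [hcen.2, mul_neg, Valuation.map_neg, ← hcen.1]; exact hA00v
  obtain ⟨A00, hA00⟩ : ∃ A : 𝒪[K], (A : K) = (ϖ ^ d₀)⁻¹ * ((g₁ : Matrix (Fin 2) (Fin 2) K) 0 0 - c) := ⟨⟨_, (Valuation.mem_integer_iff _ _).2 hA00v.le⟩, rfl⟩
  obtain ⟨A11, hA11⟩ : ∃ A : 𝒪[K], (A : K) = (ϖ ^ d₀)⁻¹ * ((g₁ : Matrix (Fin 2) (Fin 2) K) 1 1 - c) := ⟨⟨_, (Valuation.mem_integer_iff _ _).2 hA11v.le⟩, rfl⟩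
  obtain ⟨M10, hM10⟩ : ∃ A : 𝒪[K], (A : K) = (ϖ ^ d₀)⁻¹ * (g₁ : Matrix (Fin 2) (Fin 2) K) 1 0 := ⟨⟨_, (Valuation.mem_integer_iff _ _).2 hadapt.le⟩, rfl⟩
  have rA00 : IsLocalRing.residue 𝒪[K] A00 = 0 := by rw [residue_eq_zero_iff_v_lt_one, hA00]; exact hA00v
  have rA11 : IsLocalRing.residue 𝒪[K] A11 = 0 := by rw [residue_eq_zero_iff_v_lt_one, hA11]; exact hA11v
  have rM10 : IsLocalRing.residue 𝒪[K] M10 = 0 := by rw [residue_eq_zero_iff_v_lt_one, hM10]; exact hadapt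
  -- the residual value on the W-part of the frame: `l̄·x̄₂²`
  have hval : ∀ x : Fin 3 → K, (hx : ∀ i, Valued.v (x i) ≤ 1) → x 1 = 0 →
      ∃ V : 𝒪[K], (V : K) = (ϖ ^ d₀)⁻¹ * pairing σ ((StdForm.antidiagonal 3).over K) ((((u : GL (Fin 3) K)) : Matrix (Fin 3) (Fin 3) K) *ᵥ x)
          ((((γ : GL (Fin 3) K) : Matrix (Fin 3) (Fin 3) K) - c • (1 : Matrix (Fin 3) (Fin 3) K)) *ᵥ ((((u : GL (Fin 3) K)) : Matrix (Fin 3) (Fin 3) K) *ᵥ x)) ∧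
        IsLocalRing.residue 𝒪[K] V = IsLocalRing.residue 𝒪[K] LO * IsLocalRing.residue 𝒪[K] ⟨x 2, (Valuation.mem_integer_iff _ _).2 (hx 2)⟩ ^ 2 := by
    intro x hx hx1
    have hσ0 : Valued.v (σ (x 0)) ≤ 1 := (hvσ _).le.trans (hx 0)
    have hσ2 : Valued.v (σ (x 2)) ≤ 1 := (hvσ _).le.trans (hx 2)
    refine ⟨⟨σ (x 0), (Valuation.mem_integer_iff _ _).2 hσ0⟩ * (M10 * ⟨x 0, (Valuation.mem_integer_iff _ _).2 (hx 0)⟩ + A11 * ⟨x 2, (Valuation.mem_integer_iff _ _).2 (hx 2)⟩) +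
      ⟨σ (x 2), (Valuation.mem_integer_iff _ _).2 hσ2⟩ * (A00 * ⟨x 0, (Valuation.mem_integer_iff _ _).2 (hx 0)⟩ + LO * ⟨x 2, (Valuation.mem_integer_iff _ _).2 (hx 2)⟩), ?_, ?_⟩
    · rw [sub_smul_one_mulVec_frame γ u g₁ hγu, pairing_mulVec_mulVec_of_mem_unitary u.2, coe_endoGL_one_sub_smul_one_mulVec, pairing_antidiagonal_three_apply]
      push_cast
      rw [hM10, hA11, hA00, hLO, hx1]
      simp only [Fin.isValue, map_zero, mul_zero, add_zero]
      ring
    · simp only [map_add, map_mul, rM10, rA11, rA00, zero_mul, add_zero, mul_zero, zero_add]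
      rw [residue_mk_map_eq hvσ hres (x 2) (hx 2)]
      ring
  constructor
  · rintro ⟨y, hy, hy1, a, ha, hlt⟩
    set x : Fin 3 → K := ((((u : GL (Fin 3) K)) : Matrix (Fin 3) (Fin 3) K))⁻¹ *ᵥ y with hxdef
    have hxO : x ∈ stdLattice K 3 := (mem_latt_iff_of_isUnit hU y).1 (by rw [← hv1]; exact hy)
    have hyx : y = (((u : GL (Fin 3) K)) : Matrix (Fin 3) (Fin 3) K) *ᵥ x := by
      rw [hxdef, Matrix.mulVec_mulVec, Matrix.mul_nonsing_inv _ hU, Matrix.one_mulVec]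
    have hx1 : x 1 = 0 := by rw [hxdef, hu, coe_endoGL_one_inv_mulVec_apply_one]; exact hy1
    have hxi : ∀ i, Valued.v (x i) ≤ 1 := mem_stdLattice.1 hxO
    obtain ⟨V, hV, hrV⟩ := hval x hxi hx1
    rw [hyx, ← hV] at hlt
    obtain ⟨b, hb0, hb⟩ := (exists_unit_v_sub_mul_sq_lt_one_iff_residue V T₀).1 ⟨a, ha, hlt⟩
    rw [hrV] at hb
    -- `l̄ x̄₂² = t̄₀ b² ≠ 0`, so `l̄ t̄₀ = (t̄₀ b ∕ x̄₂)²`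
    have hx2 : IsLocalRing.residue 𝒪[K] ⟨x 2, (Valuation.mem_integer_iff _ _).2 (hxi 2)⟩ ≠ 0 := by
      intro h0
      rw [h0, zero_pow two_ne_zero, mul_zero] at hb
      exact (mul_ne_zero hT0 (pow_ne_zero 2 hb0)) hb.symm
    have hsq : IsLocalRing.residue 𝒪[K] LO * IsLocalRing.residue 𝒪[K] T₀ =
        (IsLocalRing.residue 𝒪[K] T₀ * b * (IsLocalRing.residue 𝒪[K] ⟨x 2, (Valuation.mem_integer_iff _ _).2 (hxi 2)⟩)⁻¹) ^ 2 := by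
      have hinv : IsLocalRing.residue 𝒪[K] ⟨x 2, (Valuation.mem_integer_iff _ _).2 (hxi 2)⟩ * (IsLocalRing.residue 𝒪[K] ⟨x 2, (Valuation.mem_integer_iff _ _).2 (hxi 2)⟩)⁻¹ = 1 :=
        mul_inv_cancel₀ hx2
      linear_combination (IsLocalRing.residue 𝒪[K] T₀ * (IsLocalRing.residue 𝒪[K] ⟨x 2, (Valuation.mem_integer_iff _ _).2 (hxi 2)⟩)⁻¹ ^ 2) * hb +
        (-(IsLocalRing.residue 𝒪[K] LO * IsLocalRing.residue 𝒪[K] T₀) *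
          (IsLocalRing.residue 𝒪[K] ⟨x 2, (Valuation.mem_integer_iff _ _).2 (hxi 2)⟩ * (IsLocalRing.residue 𝒪[K] ⟨x 2, (Valuation.mem_integer_iff _ _).2 (hxi 2)⟩)⁻¹ + 1)) * hinv
    rw [hsq]
    exact quadraticChar_sq_one' (by
      refine mul_ne_zero (mul_ne_zero hT0 hb0) (inv_ne_zero hx2))
  · intro hχ
    have hne : IsLocalRing.residue 𝒪[K] LO * IsLocalRing.residue 𝒪[K] T₀ ≠ 0 := mul_ne_zero hl hT0
    obtain ⟨r, hr⟩ := (quadraticChar_one_iff_isSquare hne).1 hχ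
    -- test vector `y = u·(T₀·e₂)`
    have hT1 : Valued.v (T₀ : K) ≤ 1 := T₀.2
    set x : Fin 3 → K := Pi.single 2 (T₀ : K) with hxdef
    have hxi : ∀ i, Valued.v (x i) ≤ 1 := fun i => by
      rcases eq_or_ne i 2 with rfl | hi
      · rw [hxdef, Pi.single_eq_same]; exact hT1
      · rw [hxdef, Pi.single_eq_of_ne hi, map_zero]; exact zero_le_one
    have hx1 : x 1 = 0 := by rw [hxdef, Pi.single_eq_of_ne (by decide)]
    have hx2 : (⟨x 2, (Valuation.mem_integer_iff _ _).2 (hxi 2)⟩ : 𝒪[K]) = T₀ := Subtype.ext (by simp [hxdef])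
    refine ⟨(((u : GL (Fin 3) K)) : Matrix (Fin 3) (Fin 3) K) *ᵥ x, by rw [hv1]; exact mulVec_mem_latt _ (mem_stdLattice.2 hxi), by
      rw [hu, coe_endoGL_one_mulVec_apply_one, hx1], ?_⟩
    obtain ⟨V, hV, hrV⟩ := hval x hxi hx1
    rw [← hV]
    refine (exists_unit_v_sub_mul_sq_lt_one_iff_residue V T₀).2 ⟨r, fun h0 => hne (by rw [hr, h0, mul_zero]), ?_⟩
    rw [hrV, hx2]
    linear_combination IsLocalRing.residue 𝒪[K] T₀ * hr

/-- **(K4b-T2′) THE SCALAR KEY WITHOUT THE REGIME** (ED. 2): in a J-symmetric block frame with `tr g₁ = 2c` (`|2| = 1`), `CO = ϖ^{−d₀}(1 − g₁,₀₀)` and `T₀ = ϖ^{−d₀}(c − 1)`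
(both in `𝒪`) satisfy `res CO = −res T₀` — no hypothesis on `|c − 1|`, so at the A-even TOP (`|c − 1| ≤ |ϖ|^{d₀+1}`, `res T₀ = 0`) it gives `res CO = 0` (chair RULING (21) (g2)).
[cite: Rogawski1990, §4.9 Lemma 4.9.3 p. 56] [cite: Kottwitz1986, §3] -/
theorem residue_CO_eq_neg_residue_T₀_of_trace (h2 : Valued.v (2 : K) = 1)
    (g₁ : Matrix (Fin 2) (Fin 2) K) {c : K} (hc : g₁.trace = 2 * c) {d₀ : ℕ}
    (hsym : Valued.v ((ϖ ^ d₀)⁻¹ * (((g₁ - 1) 0 0) - ((g₁ - 1) 1 1))) < 1)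
    (CO : 𝒪[K]) (hCO : (CO : K) = (ϖ ^ d₀)⁻¹ * (((1 : GL (Fin 1) K) : Matrix (Fin 1) (Fin 1) K) 0 0 - g₁ 0 0))
    (T₀ : 𝒪[K]) (hT₀ : (T₀ : K) = (ϖ ^ d₀)⁻¹ * (c - 1)) :
    IsLocalRing.residue 𝒪[K] CO = -IsLocalRing.residue 𝒪[K] T₀ := by
  have h20 : (2 : K) ≠ 0 := fun h0 => by rw [h0, map_zero] at h2; exact zero_ne_one h2
  have hv2 : Valued.v ((2 : K)⁻¹) = 1 := by rw [map_inv₀, h2, inv_one]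
  have hsum : IsLocalRing.residue 𝒪[K] (CO + T₀) = 0 := by
    rw [residue_eq_zero_iff_v_lt_one]
    push_cast
    have e : (ϖ ^ d₀)⁻¹ * ((((1 : GL (Fin 1) K) : Matrix (Fin 1) (Fin 1) K) 0 0) - g₁ 0 0) + (ϖ ^ d₀)⁻¹ * (c - 1) =
        -((2 : K)⁻¹ * ((ϖ ^ d₀)⁻¹ * (((g₁ - 1) 0 0) - ((g₁ - 1) 1 1)))) := by
      rw [Units.val_one, Matrix.one_apply_eq, show (1 : K) - g₁ 0 0 = -(g₁ 0 0 - c) - (c - 1) by ring, (apply_sub_centre_eq_of_trace h20 g₁ hc).1]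
      ring
    rw [hCO, hT₀, e, Valuation.map_neg, map_mul, hv2, one_mul]
    exact hsym
  rw [eq_neg_iff_add_eq_zero, ← map_add]; exact hsum

end Literature.NumberTheory.Rogawski1990.TypeOneRamifiedJunction

end
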